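import Summits.CriticalPhenomena.PercolationContinuityZ3.Theorems.PercNearOneGluingNoHeavyQuantThreeRootGenericStep
import HarnessLib

/-!
# QUANT lane R8, T-DEC: THE GENERIC THREE-TREE SIBLING GROUP INSIDE `GateStepN` — a sub-family of the open core is a theorem given the oracle

builds on p205010 (kernel theorem, internal audit signed; external expert review pending)

Support file (`--supports stmt-CriticalPhenomena-4575`), QUANT lane seat prim-quant-arm-1 (gen 46, architect); memo
`run/shared/lean/prim/quant/prim-quant-arm-1-g46/ARCH-LIGHT-G46.md` §2.  Theorems only, standard axioms, no sorries.  Sequel of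
`…QuantThreeRootGenericCoupling` (the identity, ✓) and `…QuantThreeRootGenericStep` (`sdec_threeRootGeneric_of_opened`).

THE THEOREM (`sdec_threeRootGeneric_of_oracle`).  In the binder of `LawDec.GateStepN` (lead g42: an oracle giving SDEC of every `TreeBuiltN` law with `< n`
nontrivial gates), take three opened trees `ρᵢ` — `TreeBuiltN yᵢ nᵢ Mᵢ ρᵢ`, `n₁+n₂+n₃+3 ≤ n`, boxes 1 and 2 non-empty (`0 < M₁, M₂`), means `Rᵢ` — root gates
`0 < q₂ ≤ q₁ < 1` (the pair, hub 1), `0 < q₃ < 1`, `q₃ ≤ Q = q₁+q₂−q₁q₂` (the single), STRICT re-gate positivity `(1−q₁)R₁ < R₂`, `(1−q₂)R₂ < R₁` (generic), and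
floors `w₁₂ ≤ min(y₁, (q₂/q₁)y₂)`, `v₁ ≤ min(y₁, λ₂y₂, (q₃/Q)y₃)`, `v₂ ≤ min(λ₁y₁, y₂, (q₃/Q)y₃)` (positive).  THEN the three-tree forest
`gate_{q₁}ρ₁ ∗ gate_{q₂}ρ₂ ∗ gate_{q₃}ρ₃` is SDEC at every floor `0 < x ≤ min(qᵢyᵢ, q₁w₁₂, Qv₁, Qv₂)`.  All seven SDEC inputs of the step are ORACLE calls: the opened
trees (`nᵢ < n`), the opened pair `ρ₁ ⊔ gate_{q₂/q₁}ρ₂` (≤ n₁+n₂+1 gates) and the opened hubs `G₁`, `G₂` (≤ n₁+n₂+n₃+2 gates) — `treeBuiltN_gate_le` re-gates a tree-built law inside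
the count.  With the true floors the binding condition is the slack of the two pair boxes (`Qλ₂y₂ = q₂y₂(1−(1−q₁)R₁/R₂) ≥ x`, `Qλ₁y₁ ≥ x`); the carrier (box 3) is unrestricted.
This is the environment `μ₁ = gate_{q₁}ρ₁ ∗ gate_{q₂}ρ₂` (two trees) beside the increment `gate_{q₃}ρ₃` of `GateStepN`, i.e. a generic OPEN-REGION sub-family of the width-3 core
(README V393/V397) — complementary to the tied sub-family of census-2 g71.

HONEST STATUS.  `GateStepN`, `GateStepNCore`, `FarTreeRow` remain OPEN; RATE class (log\*) and the honest sentence of `run/shared/lean/prim/quant/README.md`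
unchanged.  [this work]; oracle pattern `sdec_opened_of_oracle`: lead g42 (this lane).  Nothing here is a published result.  The gluing rows served
[cite: KozmaNitzan2024, Conjecture 3 (p. 15)]; product measure [cite: Grimmett1999, §1.3 p. 10].
-/

noncomputable section

namespace Summit.CriticalPhenomena.PercolationContinuityZ3.Theorems

namespace Quant

open Finset

namespace LawDec

/-- **re-gating a tree-built law inside the gate count**: from `TreeBuiltN (w/r) n M ρ` and `0 < r ≤ 1`, the gated law `gate ρ r` is `TreeBuiltN` at floor `w`
with at most `n + 1` nontrivial gates (`r = 1`: no gate, `gate_one`). [this work] -/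
theorem treeBuiltN_gate_le (w r : ℝ) (n M : ℕ) (ρ : ℕ → ℝ) (hr0 : 0 < r) (hr1 : r ≤ 1) (h : TreeBuiltN (w / r) n M ρ) :
    ∃ n', n' ≤ n + 1 ∧ TreeBuiltN w n' M (gate ρ r) := by
  rcases eq_or_lt_of_le hr1 with hr | hr
  · subst hr
    refine ⟨n, Nat.le_succ n, ?_⟩
    rw [gate_one]
    rw [div_one] at h
    exact h
  · refine ⟨n + 1, le_rfl, ?_⟩
    have hg : TreeBuiltN (r * (w / r)) (n + 1) M (gate ρ r) := TreeBuiltN.gate r hr0 hr h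
    have e : r * (w / r) = w := by field_simp
    rw [e] at hg
    exact hg

/-- **THE GENERIC THREE-TREE SIBLING GROUP IS SDEC GIVEN THE ORACLE** (see the module docstring). [this work] -/
theorem sdec_threeRootGeneric_of_oracle (n : ℕ) (x y₁ y₂ y₃ w₁₂ v₁ v₂ q₁ q₂ q₃ Q R₁ R₂ R₃ l₁ l₂ : ℝ) (n₁ n₂ n₃ M₁ M₂ M₃ : ℕ) (ρ₁ ρ₂ ρ₃ : ℕ → ℝ)
    (hO : ∀ (x' : ℝ) (n' M' : ℕ) (μ' : ℕ → ℝ), n' < n → TreeBuiltN x' n' M' μ' → SDEC x' M' μ')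
    (hn : n₁ + n₂ + n₃ + 3 ≤ n)
    (h₁ : TreeBuiltN y₁ n₁ M₁ ρ₁) (h₂ : TreeBuiltN y₂ n₂ M₂ ρ₂) (h₃ : TreeBuiltN y₃ n₃ M₃ ρ₃) (hM₁ : 0 < M₁) (hM₂ : 0 < M₂)
    (hR₁ : ∑ h ∈ Finset.range (M₁ + 1), (h : ℝ) * ρ₁ h = R₁) (hR₂ : ∑ h ∈ Finset.range (M₂ + 1), (h : ℝ) * ρ₂ h = R₂)
    (hR₃ : ∑ h ∈ Finset.range (M₃ + 1), (h : ℝ) * ρ₃ h = R₃)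
    (hq₂0 : 0 < q₂) (hq₂₁ : q₂ ≤ q₁) (hq₁1 : q₁ < 1) (hq₃0 : 0 < q₃) (hq₃1 : q₃ < 1) (hQ : Q = q₁ + q₂ - q₁ * q₂) (hq₃Q : q₃ ≤ Q)
    (hl₂ : l₂ = q₂ * (R₂ - (1 - q₁) * R₁) / (Q * R₂)) (hl₁ : l₁ = q₁ * (R₁ - (1 - q₂) * R₂) / (Q * R₁))
    (hl₂R : (1 - q₁) * R₁ < R₂) (hl₁R : (1 - q₂) * R₂ < R₁)
    (hw0 : 0 < w₁₂) (hwa : w₁₂ ≤ y₁) (hwb : w₁₂ ≤ q₂ / q₁ * y₂)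
    (hv₁0 : 0 < v₁) (hv₁a : v₁ ≤ y₁) (hv₁b : v₁ ≤ l₂ * y₂) (hv₁c : v₁ ≤ q₃ / Q * y₃)
    (hv₂0 : 0 < v₂) (hv₂a : v₂ ≤ l₁ * y₁) (hv₂b : v₂ ≤ y₂) (hv₂c : v₂ ≤ q₃ / Q * y₃)
    (hx0 : 0 < x) (hx₁ : x ≤ q₁ * y₁) (hx₂ : x ≤ q₂ * y₂) (hx₃ : x ≤ q₃ * y₃) (hx₁₂ : x ≤ q₁ * w₁₂) (hxv₁ : x ≤ Q * v₁) (hxv₂ : x ≤ Q * v₂) :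
    SDEC x (M₁ + M₂ + M₃) (lconv (M₁ + M₂) M₃ (lconv M₁ M₂ (gate ρ₁ q₁) (gate ρ₂ q₂)) (gate ρ₃ q₃)) := by
  obtain ⟨hy₁0, hy₁1, r₁0, r₁M, r₁1, r₁ta⟩ := h₁.lawFacts
  obtain ⟨hy₂0, hy₂1, r₂0, r₂M, r₂1, r₂ta⟩ := h₂.lawFacts
  obtain ⟨hy₃0, hy₃1, r₃0, r₃M, r₃1, r₃ta⟩ := h₃.lawFacts
  rw [hR₁] at r₁ta; rw [hR₂] at r₂ta; rw [hR₃] at r₃ta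
  have hS₁ : SDEC y₁ M₁ ρ₁ := hO y₁ n₁ M₁ ρ₁ (by omega) h₁
  have hS₂ : SDEC y₂ M₂ ρ₂ := hO y₂ n₂ M₂ ρ₂ (by omega) h₂
  have hS₃ : SDEC y₃ M₃ ρ₃ := hO y₃ n₃ M₃ ρ₃ (by omega) h₃
  -- positivity of the means of the two pair boxes
  have hR₁0 : 0 < R₁ := by
    have : (1 : ℝ) ≤ (M₁ : ℝ) := by exact_mod_cast hM₁
    nlinarith
  have hR₂0 : 0 < R₂ := by
    have : (1 : ℝ) ≤ (M₂ : ℝ) := by exact_mod_cast hM₂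
    nlinarith
  -- elementary gate bounds
  have hq₁0 : 0 < q₁ := lt_of_lt_of_le hq₂0 hq₂₁
  have hq₂1 : q₂ < 1 := lt_of_le_of_lt hq₂₁ hq₁1
  have hQq₁ : q₁ ≤ Q := by
    have t : 0 ≤ q₂ * (1 - q₁) := mul_nonneg hq₂0.le (by linarith)
    have e : Q - q₁ = q₂ * (1 - q₁) := by rw [hQ]; ring
    linarith
  have hQq₂ : q₂ ≤ Q := by
    have t : 0 ≤ q₁ * (1 - q₂) := mul_nonneg hq₁0.le (by linarith)
    have e : Q - q₂ = q₁ * (1 - q₂) := by rw [hQ]; ring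
    linarith
  have hQ0 : 0 < Q := lt_of_lt_of_le hq₁0 hQq₁
  have hr0 : 0 < q₂ / q₁ := div_pos hq₂0 hq₁0
  have hr1 : q₂ / q₁ ≤ 1 := by rw [div_le_one hq₁0]; exact hq₂₁
  have hc₃0 : 0 < q₃ / Q := div_pos hq₃0 hQ0
  have hc₃1 : q₃ / Q ≤ 1 := by rw [div_le_one hQ0]; exact hq₃Q
  have hl₂0 : 0 < l₂ := by
    rw [hl₂]; exact div_pos (mul_pos hq₂0 (by linarith)) (mul_pos hQ0 hR₂0)
  have hl₂1 : l₂ ≤ 1 := by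
    rw [hl₂, div_le_one (mul_pos hQ0 hR₂0)]
    have t1 : q₂ * R₂ ≤ Q * R₂ := mul_le_mul_of_nonneg_right hQq₂ hR₂0.le
    have t2 : 0 ≤ q₂ * ((1 - q₁) * R₁) := mul_nonneg hq₂0.le (mul_nonneg (by linarith) hR₁0.le)
    have e : q₂ * (R₂ - (1 - q₁) * R₁) = q₂ * R₂ - q₂ * ((1 - q₁) * R₁) := by ring
    linarith
  have hl₁0 : 0 < l₁ := by
    rw [hl₁]; exact div_pos (mul_pos hq₁0 (by linarith)) (mul_pos hQ0 hR₁0)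
  have hl₁1 : l₁ ≤ 1 := by
    rw [hl₁, div_le_one (mul_pos hQ0 hR₁0)]
    have t1 : q₁ * R₁ ≤ Q * R₁ := mul_le_mul_of_nonneg_right hQq₁ hR₁0.le
    have t2 : 0 ≤ q₁ * ((1 - q₂) * R₂) := mul_nonneg hq₁0.le (mul_nonneg (by linarith) hR₂0.le)
    have e : q₁ * (R₁ - (1 - q₂) * R₂) = q₁ * R₁ - q₁ * ((1 - q₂) * R₂) := by ring
    linarith
  -- ORACLE 1: the opened pair `ρ₁ ⊔ gate_{q₂/q₁} ρ₂` at floor `w₁₂`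
  have ha₁₂ : TreeBuiltN w₁₂ n₁ M₁ ρ₁ := TreeBuiltN.mono h₁ hw0 hwa
  have hb₁₂ : TreeBuiltN (w₁₂ / (q₂ / q₁)) n₂ M₂ ρ₂ :=
    TreeBuiltN.mono h₂ (div_pos hw0 hr0) (by rw [div_le_iff₀ hr0]; linarith [mul_comm (q₂ / q₁) y₂])
  obtain ⟨n₂', hn₂', hg₁₂⟩ := treeBuiltN_gate_le w₁₂ (q₂ / q₁) n₂ M₂ ρ₂ hr0 hr1 hb₁₂
  have hT₁₂ : TreeBuiltN w₁₂ (n₁ + n₂') (M₁ + M₂) (lconv M₁ M₂ ρ₁ (gate ρ₂ (q₂ / q₁))) := TreeBuiltN.conv ha₁₂ hg₁₂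
  have hG₁₂ : SDEC w₁₂ (M₁ + M₂) (lconv M₁ M₂ ρ₁ (gate ρ₂ (q₂ / q₁))) := hO w₁₂ (n₁ + n₂') (M₁ + M₂) _ (by omega) hT₁₂
  have htaG₁₂ : w₁₂ * ((M₁ + M₂ : ℕ) : ℝ) ≤ R₁ + q₂ / q₁ * R₂ := by
    obtain ⟨_, _, _, _, _, ta⟩ := hT₁₂.lawFacts
    obtain ⟨_, _, gm1⟩ := gate_laws M₂ ρ₂ (q₂ / q₁) hr0.le hr1 r₂0 r₂M r₂1
    rw [sum_mul_lconv M₁ M₂ _ _ r₁1 gm1, sum_mul_gate, hR₁, hR₂] at ta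
    exact ta
  -- ORACLE 2: the opened hub `G₁ = ρ₁ ⊔ gate_{l₂} ρ₂ ⊔ gate_{q₃/Q} ρ₃` at floor `v₁`
  have hv₁1 : v₁ < 1 := lt_of_le_of_lt hv₁a hy₁1
  have a₁ : TreeBuiltN v₁ n₁ M₁ ρ₁ := TreeBuiltN.mono h₁ hv₁0 hv₁a
  have b₁ : TreeBuiltN (v₁ / l₂) n₂ M₂ ρ₂ :=
    TreeBuiltN.mono h₂ (div_pos hv₁0 hl₂0) (by rw [div_le_iff₀ hl₂0]; linarith [mul_comm l₂ y₂])
  obtain ⟨m₂', hm₂', gb₁⟩ := treeBuiltN_gate_le v₁ l₂ n₂ M₂ ρ₂ hl₂0 hl₂1 b₁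
  have c₁ : TreeBuiltN (v₁ / (q₃ / Q)) n₃ M₃ ρ₃ :=
    TreeBuiltN.mono h₃ (div_pos hv₁0 hc₃0) (by rw [div_le_iff₀ hc₃0]; linarith [mul_comm (q₃ / Q) y₃])
  obtain ⟨m₃', hm₃', gc₁⟩ := treeBuiltN_gate_le v₁ (q₃ / Q) n₃ M₃ ρ₃ hc₃0 hc₃1 c₁
  have hT₁ : TreeBuiltN v₁ (n₁ + m₂' + m₃') (M₁ + M₂ + M₃)
      (lconv (M₁ + M₂) M₃ (lconv M₁ M₂ ρ₁ (gate ρ₂ l₂)) (gate ρ₃ (q₃ / Q))) := TreeBuiltN.conv (TreeBuiltN.conv a₁ gb₁) gc₁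
  have hG₁ : SDEC v₁ (M₁ + M₂ + M₃) (lconv (M₁ + M₂) M₃ (lconv M₁ M₂ ρ₁ (gate ρ₂ l₂)) (gate ρ₃ (q₃ / Q))) :=
    hO v₁ (n₁ + m₂' + m₃') (M₁ + M₂ + M₃) _ (by omega) hT₁
  -- ORACLE 3: the opened hub `G₂ = gate_{l₁} ρ₁ ⊔ ρ₂ ⊔ gate_{q₃/Q} ρ₃` at floor `v₂`
  have hv₂1 : v₂ < 1 := lt_of_le_of_lt hv₂b hy₂1
  have a₂ : TreeBuiltN (v₂ / l₁) n₁ M₁ ρ₁ :=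
    TreeBuiltN.mono h₁ (div_pos hv₂0 hl₁0) (by rw [div_le_iff₀ hl₁0]; linarith [mul_comm l₁ y₁])
  obtain ⟨m₁', hm₁', ga₂⟩ := treeBuiltN_gate_le v₂ l₁ n₁ M₁ ρ₁ hl₁0 hl₁1 a₂
  have b₂ : TreeBuiltN v₂ n₂ M₂ ρ₂ := TreeBuiltN.mono h₂ hv₂0 hv₂b
  have c₂ : TreeBuiltN (v₂ / (q₃ / Q)) n₃ M₃ ρ₃ :=
    TreeBuiltN.mono h₃ (div_pos hv₂0 hc₃0) (by rw [div_le_iff₀ hc₃0]; linarith [mul_comm (q₃ / Q) y₃])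
  obtain ⟨k₃', hk₃', gc₂⟩ := treeBuiltN_gate_le v₂ (q₃ / Q) n₃ M₃ ρ₃ hc₃0 hc₃1 c₂
  have hT₂ : TreeBuiltN v₂ (m₁' + n₂ + k₃') (M₁ + M₂ + M₃)
      (lconv (M₁ + M₂) M₃ (lconv M₁ M₂ (gate ρ₁ l₁) ρ₂) (gate ρ₃ (q₃ / Q))) := TreeBuiltN.conv (TreeBuiltN.conv ga₂ b₂) gc₂
  have hG₂ : SDEC v₂ (M₁ + M₂ + M₃) (lconv (M₁ + M₂) M₃ (lconv M₁ M₂ (gate ρ₁ l₁) ρ₂) (gate ρ₃ (q₃ / Q))) :=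
    hO v₂ (m₁' + n₂ + k₃') (M₁ + M₂ + M₃) _ (by omega) hT₂
  -- the step from the opened forests
  have hw1 : w₁₂ < 1 := lt_of_le_of_lt hwa hy₁1
  exact sdec_threeRootGeneric_of_opened y₁ y₂ y₃ w₁₂ v₁ v₂ x q₁ q₂ q₃ Q R₁ R₂ R₃ l₁ l₂ M₁ M₂ M₃ ρ₁ ρ₂ ρ₃
    hy₁0 hy₁1 hy₂0 hy₂1 hy₃0 hy₃1 hw0.le hw1 hv₁0.le hv₁1 hv₂0.le hv₂1 hq₂0 hq₂₁ hq₁1 hq₃0 hq₃1 hQ hq₃Q hx0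
    r₁0 r₁M r₁1 hR₁ r₁ta hR₁0 r₂0 r₂M r₂1 hR₂ r₂ta hR₂0 r₃0 r₃M r₃1 hR₃ r₃ta hS₁ hS₂ hS₃ hl₂ hl₁ hl₂R.le hl₁R.le
    hG₁₂ htaG₁₂ hG₁ hG₂ hx₁ hx₂ hx₃ hx₁₂ hxv₁ hxv₂

end LawDec

end Quant

end Summit.CriticalPhenomena.PercolationContinuityZ3.Theorems
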